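import Literature.NumberTheory.Automorphic.Liu2021.LemD1DataOfPlaceTwist
import Literature.NumberTheory.Automorphic.SchwartzBruhatL2Norm
import Literature.NumberTheory.Automorphic.AdelicSecondCountable
import HarnessLib

/-!
# [Liu2021, App. D Lem. D.1 (1)] at a finite place: the reading does not depend on the choice of UNITARY local
# splittings — at every place, split or not

Topic `NumberTheory/Automorphic/Liu2021`; namespace `Literature.NumberTheory.Automorphic.Liu2021.LemD1OfPlace` (that of
`LemD1DataOfPlace.lean` / `LemD1DataOfPlaceTwist.lean`).  KERNEL ONLY: theorems; no definition, no record, no named fact,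
no `sorry`.  Nothing of [Liu2021] is asserted.

`LemD1DataOfPlaceTwist.lean` shows: two families `𝓢, 𝓢'` of local splittings of `U(J)(F_v)` into `S̃p_{ψ_v}(𝕎_v)` give
local Weil representations `𝓢'.omegaLoc v = η_v • 𝓢.omegaLoc v` (`η_v` a character with OPEN kernel,
[GelbartRogawski1991, §3.1 Remark p. 457]); the as-printed reading of [Liu2021, App. D Lem. D.1, first sentence + (1)] at
the junction datum over ALL Step-3 characters `χ : E_v¹ → ℂ¹` passes from `𝓢` to `𝓢'` when `η_v` is UNITARY ON THE
CENTRE `E_v¹ = U(J₁)(F_v)` (rank `N ≠ 2`), which is automatic at a NON-SPLIT place (`E_v¹` compact).  At a SPLIT place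
`E_v¹ ≅ F_vˣ` is not compact and the condition is genuine: the Step-3 characters are the UNITARY characters of `E_v¹`
(print: «`χ : E^1 → ℂ^1`», l. 5221), a family which a non-unitary twist does not preserve.  (Informally — not used and not
formalised — the condition cannot be dropped: at a split place `U(V)(F_v) ≅ GL_n(F_v)` and twisting a family of local
splittings at `v` by `|det|_w^s`, `s ≠ 0`, gives another such family; for `n = 3` and a unitary `ω`, the maximal quotient of
`𝒮(F_v³)` on which the centre `F_vˣ` acts by the NON-unitary character `θ³|·|^{3/2}` — `θ(det)` the unitary character
through which the splitting enters — surjects onto the one-dimensional representation `Φ ↦ Φ(0)` of `GL_3(F_v)` and is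
infinite-dimensional (dilation-invariant distributions on `F_v³` other than `δ_0` exist), hence is REDUCIBLE and non-zero,
cf. the reducibility points of degenerate principal series [Zelevinsky1980, Thm 4.2]; twisting by `|det|^{-1/2}` moves
this quotient to the UNITARY central character `θ³`, where Lemma D.1 asserts irreducibility.  So the as-printed reading
over all Step-3 characters genuinely distinguishes unitary from non-unitary families at a split place.)

This file discharges the condition in the STANDARD way: a local Weil representation is UNITARY — every operator
preserves the `L²(F_vᴺ)` norm on the Schwartz–Bruhat model `𝒮(F_vᴺ) ⊆ L²` ([Weil1964, Chap. I n° 13];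
[MoeglinVignerasWaldspurger1987, Chap. 2 II.1]: the metaplectic group `S̃p_ψ(W)` acts on `S` by unitary operators, and
[Kudla1994, Thm 3.1] / [HarrisKudlaSweet1996, §1]: the splittings `ι_χ` over `U(V)` take values in it).  With
`Automorphic/SchwartzBruhatL2Norm.lean` (`Representation.IsL2Isometric ν ρ`: every `ρ g` preserves
`‖Φ‖²_{L²(ν)} = ∫ |Φ|² dν`; two `L²`-isometric actions on `𝒮 ≠ 0` differing by a character differ by a UNITARY one):

* §1 `forall_lemD1_1AsPrinted_of_unitary_twist` — at ANY place, a twist by an open-kernel character UNITARY ON ALL OF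
  `U(J)(F_v)` does not change the reading over all Step-3 characters (`N ≠ 2`; corollary of
  `forall_lemD1_1AsPrinted_of_twist`);
* §2 `norm_eta_eq_one_of_isL2Isometric` — if `𝓢.omegaLoc v` and `𝓢'.omegaLoc v` are both `L²(ν)`-isometric for one
  measure `ν` on `F_vᴺ` charging non-empty open sets and finite on compacts (e.g. a Haar measure), the character `η_v`
  with `𝓢'.omegaLoc v = η_v • 𝓢.omegaLoc v` is unitary;
* §2 **`forall_lemD1_1AsPrinted_iff_of_isL2Isometric`** — AT EVERY FINITE PLACE `v` (split or not), for two families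
  `𝓢, 𝓢'` of local splittings whose local Weil representations at `v` are `L²`-isometric and `N ≠ 2`:
  `(∀ χ, LemD1_1AsPrinted (data (𝓢.omegaLoc v) μ χ)) ↔ (∀ χ, LemD1_1AsPrinted (data (𝓢'.omegaLoc v) μ χ))`,
  `χ` over the unitary continuous characters of `U(J₁)(F_v)`.

So the per-place cite `hD1` of the Hodge/COR-CM cell (Lemma D.1 (1) AS PRINTED, read at the tree's ONE family of local
splittings) has the same truth value at ANY unitary family over `ι_v` — in particular at [Liu2021]'s own
`ω(μ, ε) = ω(ε) ∘ ι_μ` once the tree's metaplectic cover and Weil representation are identified with Liu's (the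
object-match duty (om1), unchanged) — PROVIDED the tree's family is itself `L²`-isometric at `v`: a statement about the
tree's explicit construction (Kudla's `χ(det)`-splitting of the Leray-normalised Schrödinger section, undoubled), which is
the remaining Track-2 target and is NOT proved here.

## References
* [Liu2021] Y. Liu, Camb. J. Math. 9 (2021) = arXiv:2102.11518, App. D §D.1 Steps 1–3 (l. 5215–5222), Lem. D.1
  (l. 5226–5229).
* [GelbartRogawski1991] S. Gelbart, J. Rogawski, Invent. Math. 105 (1991), §3.1 Remark p. 457 L4–13.
* [Weil1964] A. Weil, Acta Math. 111 (1964), Chap. I n° 11–13.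
* [MoeglinVignerasWaldspurger1987] C. Mœglin, M.-F. Vignéras, J.-L. Waldspurger, LNM 1291 (1987), Chap. 2 II.1.
* [Kudla1994] S. S. Kudla, Israel J. Math. 87 (1994), Thm 3.1.  [HarrisKudlaSweet1996] JAMS 9 (1996), §1.
* [Zelevinsky1980] A. V. Zelevinsky, Ann. Sci. ÉNS 13 (1980), Thm 4.2 (reducibility of products of segment
  representations of `GL_n`; informal remark only).
-/

set_option autoImplicit false

noncomputable section

open scoped Matrix
open NumberField IsDedekindDomain Filter
open _root_.MeasureTheory
open Literature.RepresentationTheory (SeesawScalar.twist SeesawScalar.twist_apply)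
open Literature.RepresentationTheory.Liu2021 (OscillatorStandingData)
open Literature.NumberTheory.GelbartRogawski1991.UnitaryDualPair.LocalSplitting (FinLocalSplittings)
open Literature.RepresentationTheory.HeisenbergGroup (nontrivial_schwartzBruhat_pi)

namespace Literature.NumberTheory.Automorphic.Liu2021.LemD1OfPlace

open UnitaryGroup

variable {F : Type} (E : Type) [Field F] [NumberField F] [Field E] [NumberField E] [Algebra F E]
  [Algebra.IsQuadraticExtension F E] (v : HeightOneSpectrum (𝓞 F)) (c : E ≃ₐ[F] E) (N : ℕ)
  (J : Matrix (Fin N) (Fin N) E) {δ : E} (hcδ : c δ = -δ) (hδ : δ ≠ 0) (hN : 2 ≤ N) (hJh : (J.map c)ᵀ = J)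
  (hJdet : J.det ≠ 0) (J₁ : Matrix (Fin 1) (Fin 1) E) (hJ₁ : J₁ 0 0 ≠ 0)
  (μ : (LocalRing E v)ˣ →* ℂˣ) (hμn : ∀ x, ‖((μ x : ℂˣ) : ℂ)‖ = 1) (hμc : Continuous fun x => ((μ x : ℂˣ) : ℂ))
  (hμF : ∀ a : (v.adicCompletion F)ˣ,
    μ (Units.map (algebraMap (v.adicCompletion F) (LocalRing E v)).toMonoidHom a) = 1 ↔
      ∃ x : (LocalRing E v)ˣ, (x : LocalRing E v) * conjLocal E c v x =
        algebraMap (v.adicCompletion F) (LocalRing E v) a)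

/-! ## §1 A twist by an open-kernel character unitary on the whole group never changes the reading -/

section UnitaryTwist

variable {V : Type} [AddCommGroup V] [Module ℂ V] (ω : Representation ℂ (localPi E c N J v) V)
  (η : localPi E c N J v →* ℂˣ)

include hJ₁ in
/-- **At ANY finite place: the family of readings of [Liu2021, App. D Lem. D.1, first sentence + (1)] AS PRINTED over
ALL Step-3 characters passes from `ω` to `η • ω` for an open-kernel character `η` of `U(J)(F_v)` that is UNITARY (on the
whole group, hence on the centre)**, rank `N ≠ 2` — `forall_lemD1_1AsPrinted_of_twist` with the centre condition
discharged. [cite: Liu2021, App. D Lemma D.1 (l. 5227–5229)] [cite: GelbartRogawski1991, §3.1 Remark p. 457 L4–13] -/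
theorem forall_lemD1_1AsPrinted_of_unitary_twist (hN2 : N ≠ 2)
    (hker : IsOpen ((η.ker : Subgroup (localPi E c N J v)) : Set (localPi E c N J v)))
    (hηu : ∀ g : localPi E c N J v, ‖((η g : ℂˣ) : ℂ)‖ = 1)
    (H : ∀ (χ : localPi E c 1 J₁ v →* ℂˣ) (hχn : ∀ h, ‖((χ h : ℂˣ) : ℂ)‖ = 1)
      (hχc : Continuous fun h => ((χ h : ℂˣ) : ℂ)),
      LemD1_1AsPrinted (data E v c N J hcδ hδ hN hJh hJdet J₁ ω μ hμn hμc hμF χ hχn hχc))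
    (χ : localPi E c 1 J₁ v →* ℂˣ) (hχn : ∀ h, ‖((χ h : ℂˣ) : ℂ)‖ = 1)
    (hχc : Continuous fun h => ((χ h : ℂˣ) : ℂ)) :
    LemD1_1AsPrinted (data E v c N J hcδ hδ hN hJh hJdet J₁ (SeesawScalar.twist η ω) μ hμn hμc hμF χ hχn hχc) :=
  forall_lemD1_1AsPrinted_of_twist E v c N J hcδ hδ hN hJh hJdet J₁ hJ₁ η
    (fun h => hηu (localCenter E c N J J₁ hJ₁ v h)) ω μ hμn hμc hμF hN2 hker H χ hχn hχc

end UnitaryTwist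

/-! ## §2 Two `L²`-isometric families of local splittings give the same reading, at every place -/

section Isometric

variable {d : F} {hd : δ * δ = algebraMap F E d} {T : Matrix (Fin N) (Fin N) F} {hT : T.IsSymm}
  {hJ : J = T.map (algebraMap F E)}
  [MeasurableSpace (v.adicCompletion F)] [BorelSpace (v.adicCompletion F)]
  (ν : Measure (Fin N → v.adicCompletion F)) [ν.IsOpenPosMeasure] [IsFiniteMeasureOnCompacts ν]

/-- **Two families of local splittings whose local Weil representations at `v` are `L²(ν)`-isometric differ there by a
UNITARY character**: if `𝓢'.omegaLoc v = η • 𝓢.omegaLoc v` then `|η(g)| = 1` for all `g ∈ U(J)(F_v)` (`ν` any measure on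
`F_vᴺ` charging non-empty open sets and finite on compacts, e.g. a Haar measure; `𝒮(F_vᴺ) ≠ 0`).
[cite: Weil1964, Chap. I n° 13] [cite: GelbartRogawski1991, §3.1 Remark p. 457 L4–13] -/
theorem norm_eta_eq_one_of_isL2Isometric (𝓢 𝓢' : FinLocalSplittings F E c N hcδ hδ hd T hT hJ)
    (h𝓢 : (𝓢.omegaLoc v).IsL2Isometric ν) (h𝓢' : (𝓢'.omegaLoc v).IsL2Isometric ν)
    (η : localPi E c N J v →* ℂˣ) (hη : 𝓢'.omegaLoc v = SeesawScalar.twist η (𝓢.omegaLoc v))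
    (g : localPi E c N J v) : ‖((η g : ℂˣ) : ℂ)‖ = 1 := by
  haveI := secondCountableTopology_adicCompletion F v
  haveI : Nontrivial (SchwartzBruhat (Fin N → v.adicCompletion F)) := nontrivial_schwartzBruhat_pi
  exact h𝓢.norm_eq_one_of_twist h𝓢' η hη g

include hJ₁ in
/-- one direction of `forall_lemD1_1AsPrinted_iff_of_isL2Isometric`, for an ordered pair of families.
[cite: Liu2021, App. D Lemma D.1 (l. 5227–5229)] -/
private theorem forall_lemD1_1AsPrinted_of_isL2Isometric (hN2 : N ≠ 2) (hTd : IsUnit T.det)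
    (𝓢 𝓢' : FinLocalSplittings F E c N hcδ hδ hd T hT hJ)
    (h𝓢 : (𝓢.omegaLoc v).IsL2Isometric ν) (h𝓢' : (𝓢'.omegaLoc v).IsL2Isometric ν)
    (H : ∀ (χ : localPi E c 1 J₁ v →* ℂˣ) (hχn : ∀ h, ‖((χ h : ℂˣ) : ℂ)‖ = 1)
      (hχc : Continuous fun h => ((χ h : ℂˣ) : ℂ)),
      LemD1_1AsPrinted (data E v c N J hcδ hδ hN hJh hJdet J₁ (𝓢.omegaLoc v) μ hμn hμc hμF χ hχn hχc))
    (χ : localPi E c 1 J₁ v →* ℂˣ) (hχn : ∀ h, ‖((χ h : ℂˣ) : ℂ)‖ = 1)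
    (hχc : Continuous fun h => ((χ h : ℂˣ) : ℂ)) :
    LemD1_1AsPrinted (data E v c N J hcδ hδ hN hJh hJdet J₁ (𝓢'.omegaLoc v) μ hμn hμc hμF χ hχn hχc) := by
  obtain ⟨η, hker, hη⟩ := 𝓢.exists_twist_omegaLoc hTd 𝓢' v
  have hηu := norm_eta_eq_one_of_isL2Isometric E v c N J hcδ hδ ν 𝓢 𝓢' h𝓢 h𝓢' η hη
  rw [hη]
  exact forall_lemD1_1AsPrinted_of_unitary_twist E v c N J hcδ hδ hN hJh hJdet J₁ hJ₁ μ hμn hμc hμF (𝓢.omegaLoc v) η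
    hN2 hker hηu H χ hχn hχc

include hJ₁ in
/-- **AT EVERY FINITE PLACE — split or not — the reading of [Liu2021, App. D Lem. D.1, first sentence + (1)] AS
PRINTED for ALL Step-3 characters is the same for any two UNITARY families of local splittings** (rank `N ≠ 2`): for two
restricted families `𝓢, 𝓢'` of local splittings of `U(J)(F_v)` into `S̃p_{ψ_v}(𝕎_v)` (`J = T ⊗ 1`, `det T` a unit) whose
local Weil representations at `v` are `L²(ν)`-isometric on `𝒮(F_vᴺ)` (`ν` charging non-empty open sets, finite on
compacts — e.g. the Haar measure: UNITARITY of the two Weil representations),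
`(∀ χ, LemD1_1AsPrinted (data (𝓢.omegaLoc v) μ χ)) ↔ (∀ χ, LemD1_1AsPrinted (data (𝓢'.omegaLoc v) μ χ))`, `χ` over
the unitary continuous characters of the centre `U(J₁)(F_v) = E_v¹`.  Ingredients: the two Weil representations differ
by an open-kernel character ([GelbartRogawski1991, §3.1 Remark p. 457]) which is unitary because both are
`L²`-isometric (`norm_eta_eq_one_of_isL2Isometric`), and §1.  The non-split case without any unitarity hypothesis is
`forall_lemD1_1AsPrinted_iff_of_nonsplit`. [cite: Liu2021, App. D Lemma D.1 (l. 5227–5229)]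
[cite: GelbartRogawski1991, §3.1 Remark p. 457 L4–13] [cite: Weil1964, Chap. I n° 13] -/
theorem forall_lemD1_1AsPrinted_iff_of_isL2Isometric (hN2 : N ≠ 2) (hTd : IsUnit T.det)
    (𝓢 𝓢' : FinLocalSplittings F E c N hcδ hδ hd T hT hJ)
    (h𝓢 : (𝓢.omegaLoc v).IsL2Isometric ν) (h𝓢' : (𝓢'.omegaLoc v).IsL2Isometric ν) :
    (∀ (χ : localPi E c 1 J₁ v →* ℂˣ) (hχn : ∀ h, ‖((χ h : ℂˣ) : ℂ)‖ = 1)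
        (hχc : Continuous fun h => ((χ h : ℂˣ) : ℂ)),
        LemD1_1AsPrinted (data E v c N J hcδ hδ hN hJh hJdet J₁ (𝓢.omegaLoc v) μ hμn hμc hμF χ hχn hχc)) ↔
      (∀ (χ : localPi E c 1 J₁ v →* ℂˣ) (hχn : ∀ h, ‖((χ h : ℂˣ) : ℂ)‖ = 1)
        (hχc : Continuous fun h => ((χ h : ℂˣ) : ℂ)),
        LemD1_1AsPrinted (data E v c N J hcδ hδ hN hJh hJdet J₁ (𝓢'.omegaLoc v) μ hμn hμc hμF χ hχn hχc)) :=
  ⟨forall_lemD1_1AsPrinted_of_isL2Isometric E v c N J hcδ hδ hN hJh hJdet J₁ hJ₁ μ hμn hμc hμF ν hN2 hTd 𝓢 𝓢' h𝓢 h𝓢',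
    forall_lemD1_1AsPrinted_of_isL2Isometric E v c N J hcδ hδ hN hJh hJdet J₁ hJ₁ μ hμn hμc hμF ν hN2 hTd 𝓢' 𝓢 h𝓢' h𝓢⟩

end Isometric

end Literature.NumberTheory.Automorphic.Liu2021.LemD1OfPlace

end
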